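import Mathlib
import HarnessLib
import Literature.Probability.ImportanceSampling.ChatterjeeDiaconis
import Summits.Ventures.LatticeQCDFlow.Exactness.NCMCGeneralSpaceRelativeEntropy

/-!
# NCMCGeneralSpaceSampleSize — Chatterjee–Diaconis for a Crooks pair on a GENERAL state space:
# the Jarzynski / reweighting estimators from `N` independent forward records need
# `N ≈ exp KL(P_R ‖ P_F) = exp E_{P_R}[ΔF − W]`

HONEST FRAMING: exact (Metropolis-corrected) sampling algorithms for lattice gauge theory;
figures of merit are autocorrelation/cost numbers at stated couplings and volumes; no
continuum-physics claim.

Venture `LatticeQCDFlow` (cell pub-lqcd); FANOUT row 19 (`su2-snf`, GEN-7), filed next to row 13's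
`Exactness/NCMCGeneralSpace*` series which it docks.  A DOCKING file: the theorem is the
Literature's **Chatterjee–Diaconis sample-size theorem**
(`Literature/Probability/ImportanceSampling/ChatterjeeDiaconis`, Ann. Appl. Probab. 28 (2018)
Thm 1.1, PROVED there), the setting is row 13's Crooks pair `(κF, κR, s, e, W)` from `ν₀` to `ν₁`
on a general measurable state space with the normalised record laws `P_F = fwdPathLaw ν₀ κF`,
`P_R = fwdPathLaw ν₁ κR` and `e^{−ΔF} = Z₁/Z₀` (`Exactness/NCMCGeneralSpaceRelativeEntropy`:
`revPathLaw_eq_withDensity` — `dP_R/dP_F = e^{ΔF − W}`; `llr_rev_fwd`; `toReal_klDiv_rev_fwd` —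
`KL(P_R ‖ P_F) = E_{P_R}[ΔF − W]`).  Proposal `μ = P_F`, target `ν = P_R`: the Literature's
importance-sampling estimate `I_N(f)` is the Jarzynski-reweighted average
`(1/N) Σᵢ f(εᵢ) e^{ΔF − W(εᵢ)}` of `N` INDEPENDENT forward records (`P_F^{⊗N}`-a.s.), `I_N(1)` is
`Ẑ_N·e^{ΔF}`, and the exponent `L` is `KL(P_R ‖ P_F) = E_{P_R}[ΔF − W]`, the mean work dissipated
by the REVERSE process.  The finite path-space version (explicit sums) is this seat's
`Scaling/JarzynskiSampleSize`; nothing is cited as a fact; OUR WORK is bookkeeping only.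

* `rnDeriv_rev_fwd_ae` — `dP_R/dP_F = e^{ΔF − W}` `P_F`-a.e. (Mathlib `rnDeriv`);
* `ae_pi_rnDeriv_eq_exp` — on the `N`-sample space `P_F^{⊗N}`, a.s. every coordinate's density is
  `e^{ΔF − W(εᵢ)}` (coordinate maps are measure preserving);
* **`sampleSize_necessary`** — `t ≥ 0`, `N ≤ exp(E_{P_R}[ΔF − W] − t)`, `δ ∈ (0, 1)` ⇒
  `P_F^{⊗N}{ (1/N)Σᵢ e^{ΔF − W(εᵢ)} ≥ 1 − δ } ≤ e^{−t/2} + P_R{ΔF − W ≤ E_{P_R}[ΔF − W] − t/2}/(1 − δ)`: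
  with too few independent forward records the Jarzynski estimator `Ẑ_N = (1/N)Σ e^{−Wᵢ}` falls
  short of `e^{−ΔF}` by the factor `1 − δ` (so `ΔF̂_N > ΔF − log(1 − δ)`) except on that event;
* **`sampleSize_sufficient`** — `t ≥ 0`, `N ≥ exp(E_{P_R}[ΔF − W] + t)`, `f ∈ L²(P_R)` measurable ⇒
  `E|(1/N)Σᵢ f(εᵢ)e^{ΔF − W(εᵢ)} − E_{P_R} f| ≤ ‖f‖_{L²(P_R)}·(e^{−t/4} + 2√(P_R{E_{P_R}[ΔF − W] + t/2 < ΔF − W}))`;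
* **`sampleSize_sufficient_of_essPop`** — the same with `N ≥ e^{t}/ESS_F`, `ESS_F` the population
  ESS of the forward weights (row 13's `essPop_le_exp_neg_rev_dissipation`:
  `KL(P_R ‖ P_F) ≤ −log ESS_F`): `1/ESS_F` independent forward records (times `e^{t}`) SUFFICE.

NOT CLAIMED: correlated records (restart chains); the sample Kish ESS; any value of `E_{P_R}[W]`
for a concrete protocol (when `W ∉ L¹(P_R)` the typed exponent is `0` by Mathlib's convention for
the Bochner integral, exactly as in the Literature file).
-/

namespace Summit.Ventures.LatticeQCDFlow.Exactness.GeneralNCMC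

open MeasureTheory ProbabilityTheory Set Filter
open scoped ENNReal
open Literature.Probability.ImportanceSampling (isEstimate ChatterjeeDiaconis2018_sampleSize_holds)

variable {Ω E : Type*} [MeasurableSpace Ω] [MeasurableSpace E]

namespace CrooksPair

variable {ν₀ ν₁ : Measure Ω} {κF κR : Kernel Ω E} {s e : E → Ω} {W : E → ℝ}

/-- **`dP_R/dP_F = e^{ΔF − W}`, `P_F`-almost everywhere** (Mathlib's Radon–Nikodym derivative of the
reverse record law against the forward one). -/
theorem rnDeriv_rev_fwd_ae [IsFiniteMeasure ν₀] [IsFiniteMeasure ν₁] [IsMarkovKernel κF]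
    [IsMarkovKernel κR] (h0 : ν₀ univ ≠ 0) (h1 : ν₁ univ ≠ 0)
    (h : CrooksPair ν₀ ν₁ κF κR s e W) {ΔF : ℝ}
    (hΔF : Real.exp (-ΔF) = ((ν₀ univ)⁻¹ * ν₁ univ).toReal) :
    (fwdPathLaw ν₁ κR).rnDeriv (fwdPathLaw ν₀ κF)
      =ᵐ[fwdPathLaw ν₀ κF] fun ε => ENNReal.ofReal (Real.exp (ΔF - W ε)) := by
  haveI := isProbabilityMeasure_fwdPathLaw ν₀ h0 κF
  have hW := h.measurable_W
  have hmeas : Measurable fun ε => ENNReal.ofReal (Real.exp (ΔF - W ε)) :=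
    Measurable.ennreal_ofReal (by fun_prop)
  have hrn := Measure.rnDeriv_withDensity (fwdPathLaw ν₀ κF) hmeas
  rwa [← h.revPathLaw_eq_withDensity h0 h1 hΔF] at hrn

/-- On the `N`-sample space `P_F^{⊗N}` (independent forward records), almost surely EVERY
coordinate's density is `e^{ΔF − W(εᵢ)}` (the coordinate maps are measure preserving). -/
theorem ae_pi_rnDeriv_eq_exp [IsFiniteMeasure ν₀] [IsFiniteMeasure ν₁] [IsMarkovKernel κF]
    [IsMarkovKernel κR] (h0 : ν₀ univ ≠ 0) (h1 : ν₁ univ ≠ 0)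
    (h : CrooksPair ν₀ ν₁ κF κR s e W) {ΔF : ℝ}
    (hΔF : Real.exp (-ΔF) = ((ν₀ univ)⁻¹ * ν₁ univ).toReal) (N : ℕ) :
    ∀ᵐ x ∂(Measure.pi fun _ : Fin N => fwdPathLaw ν₀ κF), ∀ i : Fin N,
      ((fwdPathLaw ν₁ κR).rnDeriv (fwdPathLaw ν₀ κF) (x i)).toReal = Real.exp (ΔF - W (x i)) := by
  haveI := isProbabilityMeasure_fwdPathLaw ν₀ h0 κF
  rw [ae_all_iff]
  intro i
  have hq := (measurePreserving_eval (fun _ : Fin N => fwdPathLaw ν₀ κF) i).quasiMeasurePreserving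
  filter_upwards [hq.ae_eq (h.rnDeriv_rev_fwd_ae h0 h1 hΔF)] with x hx
  have hx' : (fwdPathLaw ν₁ κR).rnDeriv (fwdPathLaw ν₀ κF) (x i)
      = ENNReal.ofReal (Real.exp (ΔF - W (x i))) := hx
  rw [hx', ENNReal.toReal_ofReal (Real.exp_pos _).le]

/-- The Literature's exponent `∫ log(dP_R/dP_F) dP_R` is `KL(P_R ‖ P_F) = E_{P_R}[ΔF − W]`. -/
theorem integral_log_rnDeriv_rev_fwd [IsFiniteMeasure ν₀] [IsFiniteMeasure ν₁] [IsMarkovKernel κF]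
    [IsMarkovKernel κR] (h0 : ν₀ univ ≠ 0) (h1 : ν₁ univ ≠ 0)
    (h : CrooksPair ν₀ ν₁ κF κR s e W) {ΔF : ℝ}
    (hΔF : Real.exp (-ΔF) = ((ν₀ univ)⁻¹ * ν₁ univ).toReal) :
    ∫ ε, Real.log ((fwdPathLaw ν₁ κR).rnDeriv (fwdPathLaw ν₀ κF) ε).toReal ∂(fwdPathLaw ν₁ κR)
      = ∫ ε, (ΔF - W ε) ∂(fwdPathLaw ν₁ κR) :=
  integral_congr_ae (h.llr_rev_fwd h0 h1 hΔF)

/-- **SAMPLE SIZE, NECESSITY (general state space).**  For a Crooks pair, `t ≥ 0`,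
`N ≤ exp(E_{P_R}[ΔF − W] − t)` and `δ ∈ (0, 1)`: among `N` INDEPENDENT forward records,
`P( (1/N)Σᵢ e^{ΔF − W(εᵢ)} ≥ 1 − δ ) ≤ e^{−t/2} + P_R{ΔF − W ≤ E_{P_R}[ΔF − W] − t/2}/(1 − δ)` — the
Jarzynski estimator needs `≈ exp KL(P_R ‖ P_F)` records (Chatterjee–Diaconis Thm 1.1, second
display). -/
theorem sampleSize_necessary [IsFiniteMeasure ν₀] [IsFiniteMeasure ν₁] [IsMarkovKernel κF]
    [IsMarkovKernel κR] (h0 : ν₀ univ ≠ 0) (h1 : ν₁ univ ≠ 0)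
    (h : CrooksPair ν₀ ν₁ κF κR s e W) {ΔF : ℝ}
    (hΔF : Real.exp (-ΔF) = ((ν₀ univ)⁻¹ * ν₁ univ).toReal) {t : ℝ} (ht : 0 ≤ t) {N : ℕ}
    (hN : (N : ℝ) ≤ Real.exp ((∫ ε, (ΔF - W ε) ∂(fwdPathLaw ν₁ κR)) - t))
    {δ : ℝ} (hδ0 : 0 < δ) (hδ1 : δ < 1) :
    ((Measure.pi fun _ : Fin N => fwdPathLaw ν₀ κF)
        {x | 1 - δ ≤ (1 / (N : ℝ)) * ∑ i, Real.exp (ΔF - W (x i))}).toReal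
      ≤ Real.exp (-t / 2)
        + ((fwdPathLaw ν₁ κR) {ε | ΔF - W ε ≤ (∫ ε', (ΔF - W ε') ∂(fwdPathLaw ν₁ κR)) - t / 2}).toReal
          / (1 - δ) := by
  haveI := isProbabilityMeasure_fwdPathLaw ν₀ h0 κF
  haveI := isProbabilityMeasure_fwdPathLaw ν₁ h1 κR
  have hCD := (ChatterjeeDiaconis2018_sampleSize_holds E (fwdPathLaw ν₀ κF) (fwdPathLaw ν₁ κR)
    (h.revPathLaw_absolutelyContinuous h0 h1) (fun _ => (1 : ℝ)) measurable_const
    (memLp_const 1) t ht).2 N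
  rw [h.integral_log_rnDeriv_rev_fwd h0 h1 hΔF] at hCD
  have hmain := hCD hN δ hδ0 hδ1
  -- the event, up to a `P_F^{⊗N}`-null set
  have hev : {x : Fin N → E | 1 - δ ≤ isEstimate (fwdPathLaw ν₀ κF) (fwdPathLaw ν₁ κR)
        (fun _ => (1 : ℝ)) N x}
      =ᵐ[Measure.pi fun _ : Fin N => fwdPathLaw ν₀ κF]
        ({x : Fin N → E | 1 - δ ≤ (1 / (N : ℝ)) * ∑ i, Real.exp (ΔF - W (x i))} : Set _) := by
    filter_upwards [h.ae_pi_rnDeriv_eq_exp h0 h1 hΔF N] with x hx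
    simp only [eq_iff_iff]
    dsimp only [setOf]
    simp only [isEstimate, one_mul]
    rw [Finset.sum_congr rfl fun i _ => hx i]
  -- the tail event, up to a `P_R`-null set
  have htail : {ε | Real.log ((fwdPathLaw ν₁ κR).rnDeriv (fwdPathLaw ν₀ κF) ε).toReal
        ≤ (∫ ε', (ΔF - W ε') ∂(fwdPathLaw ν₁ κR)) - t / 2}
      =ᵐ[fwdPathLaw ν₁ κR]
        ({ε | ΔF - W ε ≤ (∫ ε', (ΔF - W ε') ∂(fwdPathLaw ν₁ κR)) - t / 2} : Set E) := by
    filter_upwards [h.llr_rev_fwd h0 h1 hΔF] with ε hε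
    simp only [eq_iff_iff]
    dsimp only [setOf]
    rw [← hε, llr]
  rw [measure_congr hev, measure_congr htail] at hmain
  exact hmain

/-- **SAMPLE SIZE, SUFFICIENCY (general state space).**  For a Crooks pair, `t ≥ 0`,
`N ≥ exp(E_{P_R}[ΔF − W] + t)` and a measurable `f ∈ L²(P_R)`: the Jarzynski-reweighted average of
`N` INDEPENDENT forward records estimates `E_{P_R} f` with
`E|(1/N)Σᵢ f(εᵢ)e^{ΔF − W(εᵢ)} − E_{P_R} f| ≤ ‖f‖_{L²(P_R)}·(e^{−t/4} + 2√(P_R{E_{P_R}[ΔF − W] + t/2 < ΔF − W}))`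
(Chatterjee–Diaconis Thm 1.1, first display). -/
theorem sampleSize_sufficient [IsFiniteMeasure ν₀] [IsFiniteMeasure ν₁] [IsMarkovKernel κF]
    [IsMarkovKernel κR] (h0 : ν₀ univ ≠ 0) (h1 : ν₁ univ ≠ 0)
    (h : CrooksPair ν₀ ν₁ κF κR s e W) {ΔF : ℝ}
    (hΔF : Real.exp (-ΔF) = ((ν₀ univ)⁻¹ * ν₁ univ).toReal)
    {f : E → ℝ} (hf : Measurable f) (hf2 : MemLp f 2 (fwdPathLaw ν₁ κR))
    {t : ℝ} (ht : 0 ≤ t) {N : ℕ}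
    (hN : Real.exp ((∫ ε, (ΔF - W ε) ∂(fwdPathLaw ν₁ κR)) + t) ≤ N) :
    ∫ x, |(1 / (N : ℝ)) * ∑ i, f (x i) * Real.exp (ΔF - W (x i)) - ∫ ε, f ε ∂(fwdPathLaw ν₁ κR)|
        ∂(Measure.pi fun _ : Fin N => fwdPathLaw ν₀ κF)
      ≤ Real.sqrt (∫ ε, f ε ^ 2 ∂(fwdPathLaw ν₁ κR)) *
          (Real.exp (-t / 4) + 2 * Real.sqrt ((fwdPathLaw ν₁ κR)
            {ε | (∫ ε', (ΔF - W ε') ∂(fwdPathLaw ν₁ κR)) + t / 2 < ΔF - W ε}).toReal) := by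
  haveI := isProbabilityMeasure_fwdPathLaw ν₀ h0 κF
  haveI := isProbabilityMeasure_fwdPathLaw ν₁ h1 κR
  have hCD := (ChatterjeeDiaconis2018_sampleSize_holds E (fwdPathLaw ν₀ κF) (fwdPathLaw ν₁ κR)
    (h.revPathLaw_absolutelyContinuous h0 h1) f hf hf2 t ht).1 N
  rw [h.integral_log_rnDeriv_rev_fwd h0 h1 hΔF] at hCD
  have hmain := hCD hN
  -- the integrand, up to a `P_F^{⊗N}`-null set
  have hint : (fun x : Fin N → E => |isEstimate (fwdPathLaw ν₀ κF) (fwdPathLaw ν₁ κR) f N x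
        - ∫ ε, f ε ∂(fwdPathLaw ν₁ κR)|)
      =ᵐ[Measure.pi fun _ : Fin N => fwdPathLaw ν₀ κF]
        fun x => |(1 / (N : ℝ)) * ∑ i, f (x i) * Real.exp (ΔF - W (x i))
          - ∫ ε, f ε ∂(fwdPathLaw ν₁ κR)| := by
    filter_upwards [h.ae_pi_rnDeriv_eq_exp h0 h1 hΔF N] with x hx
    simp only [isEstimate]
    rw [Finset.sum_congr rfl fun i _ => by rw [hx i]]
  -- the tail event, up to a `P_R`-null set
  have htail : {ε | (∫ ε', (ΔF - W ε') ∂(fwdPathLaw ν₁ κR)) + t / 2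
        < Real.log ((fwdPathLaw ν₁ κR).rnDeriv (fwdPathLaw ν₀ κF) ε).toReal}
      =ᵐ[fwdPathLaw ν₁ κR]
        ({ε | (∫ ε', (ΔF - W ε') ∂(fwdPathLaw ν₁ κR)) + t / 2 < ΔF - W ε} : Set E) := by
    filter_upwards [h.llr_rev_fwd h0 h1 hΔF] with ε hε
    simp only [eq_iff_iff]
    dsimp only [setOf]
    rw [← hε, llr]
  rw [integral_congr_ae hint, measure_congr htail] at hmain
  exact hmain

/-- **`N ≥ e^{t}/ESS_F` INDEPENDENT FORWARD RECORDS SUFFICE** — the sufficiency with the exponent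
replaced by the population ESS of the forward weights, `ESS_F = (E_{P_F} e^{−W})²/E_{P_F} e^{−2W}`
(`KL(P_R ‖ P_F) = E_{P_R}[ΔF − W] ≤ −log ESS_F` is row 13's
`essPop_le_exp_neg_rev_dissipation`). -/
theorem sampleSize_sufficient_of_essPop [IsFiniteMeasure ν₀] [IsFiniteMeasure ν₁]
    [IsMarkovKernel κF] [IsMarkovKernel κR] (h0 : ν₀ univ ≠ 0) (h1 : ν₁ univ ≠ 0)
    (h : CrooksPair ν₀ ν₁ κF κR s e W) {ΔF : ℝ}
    (hΔF : Real.exp (-ΔF) = ((ν₀ univ)⁻¹ * ν₁ univ).toReal)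
    {f : E → ℝ} (hf : Measurable f) (hf2 : MemLp f 2 (fwdPathLaw ν₁ κR))
    {t : ℝ} (ht : 0 ≤ t) {N : ℕ}
    (hE : 0 < (∫ ε, Real.exp (-W ε) ∂(fwdPathLaw ν₀ κF)) ^ 2
      / ∫ ε, Real.exp (-(2 * W ε)) ∂(fwdPathLaw ν₀ κF))
    (hN : Real.exp t / ((∫ ε, Real.exp (-W ε) ∂(fwdPathLaw ν₀ κF)) ^ 2
      / ∫ ε, Real.exp (-(2 * W ε)) ∂(fwdPathLaw ν₀ κF)) ≤ N) :
    ∫ x, |(1 / (N : ℝ)) * ∑ i, f (x i) * Real.exp (ΔF - W (x i)) - ∫ ε, f ε ∂(fwdPathLaw ν₁ κR)|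
        ∂(Measure.pi fun _ : Fin N => fwdPathLaw ν₀ κF)
      ≤ Real.sqrt (∫ ε, f ε ^ 2 ∂(fwdPathLaw ν₁ κR)) *
          (Real.exp (-t / 4) + 2 * Real.sqrt ((fwdPathLaw ν₁ κR)
            {ε | (∫ ε', (ΔF - W ε') ∂(fwdPathLaw ν₁ κR)) + t / 2 < ΔF - W ε}).toReal) := by
  refine h.sampleSize_sufficient h0 h1 hΔF hf hf2 ht (le_trans ?_ hN)
  have hb := h.essPop_le_exp_neg_rev_dissipation h0 h1 hΔF
  set ESS := (∫ ε, Real.exp (-W ε) ∂(fwdPathLaw ν₀ κF)) ^ 2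
      / ∫ ε, Real.exp (-(2 * W ε)) ∂(fwdPathLaw ν₀ κF) with hESS
  have hL : ∫ ε, (ΔF - W ε) ∂(fwdPathLaw ν₁ κR) ≤ -Real.log ESS := by
    have := Real.log_le_log hE hb
    rw [Real.log_exp] at this
    linarith
  calc Real.exp ((∫ ε, (ΔF - W ε) ∂(fwdPathLaw ν₁ κR)) + t)
      ≤ Real.exp (-Real.log ESS + t) := Real.exp_le_exp.mpr (by linarith)
    _ = Real.exp t / ESS := by rw [Real.exp_add, Real.exp_neg, Real.exp_log hE, inv_mul_eq_div]

end CrooksPair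

end Summit.Ventures.LatticeQCDFlow.Exactness.GeneralNCMC

/-! ## §A (GEN-8 append) The Jarzynski estimator itself, the free-energy reading, the reverse lane

Three readings of the two laws above that the NE-MCMC write-up uses directly: the estimator of
`e^{−ΔF}` itself (`f = 1`); the printed free-energy estimate `ΔF̂_N = −log Ẑ_N`, which with too few
records OVER-estimates `ΔF` by at least `log(1/(1 − δ))` outside an event of the printed
probability; and the REVERSE lane, whose sample size is governed by the FORWARD dissipation
`E_{P_F}[W − ΔF]` (the pair read backwards, `CrooksPair.symm`): a two-sided run certifies each lane's
sample-size exponent from the other lane's mean work. -/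

namespace Summit.Ventures.LatticeQCDFlow.Exactness.GeneralNCMC

namespace CrooksPair

open MeasureTheory ProbabilityTheory Set Filter
open scoped ENNReal

variable {Ω E : Type*} [MeasurableSpace Ω] [MeasurableSpace E]
variable {ν₀ ν₁ : Measure Ω} {κF κR : Kernel Ω E} {s e : E → Ω} {W : E → ℝ}

/-- **THE JARZYNSKI ESTIMATOR, SUFFICIENCY** (`f = 1`): `t ≥ 0`, `N ≥ exp(E_{P_R}[ΔF − W] + t)`
independent forward records ⇒ `E|Ẑ_N·e^{ΔF} − 1| ≤ e^{−t/4} + 2√(P_R{E_{P_R}[ΔF − W] + t/2 < ΔF − W})`,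
`Ẑ_N = (1/N)Σᵢ e^{−W(εᵢ)}`. -/
theorem jarzynski_sampleSize_sufficient [IsFiniteMeasure ν₀] [IsFiniteMeasure ν₁]
    [IsMarkovKernel κF] [IsMarkovKernel κR] (h0 : ν₀ univ ≠ 0) (h1 : ν₁ univ ≠ 0)
    (h : CrooksPair ν₀ ν₁ κF κR s e W) {ΔF : ℝ}
    (hΔF : Real.exp (-ΔF) = ((ν₀ univ)⁻¹ * ν₁ univ).toReal) {t : ℝ} (ht : 0 ≤ t) {N : ℕ}
    (hN : Real.exp ((∫ ε, (ΔF - W ε) ∂(fwdPathLaw ν₁ κR)) + t) ≤ N) :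
    ∫ x, |(1 / (N : ℝ)) * ∑ i, Real.exp (ΔF - W (x i)) - 1|
        ∂(Measure.pi fun _ : Fin N => fwdPathLaw ν₀ κF)
      ≤ Real.exp (-t / 4) + 2 * Real.sqrt ((fwdPathLaw ν₁ κR)
            {ε | (∫ ε', (ΔF - W ε') ∂(fwdPathLaw ν₁ κR)) + t / 2 < ΔF - W ε}).toReal := by
  haveI := isProbabilityMeasure_fwdPathLaw ν₁ h1 κR
  have key := h.sampleSize_sufficient h0 h1 hΔF (f := fun _ => (1 : ℝ)) measurable_const
    (memLp_const 1) ht hN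
  simp only [one_mul, one_pow, integral_const, probReal_univ, smul_eq_mul, mul_one,
    Real.sqrt_one] at key
  exact key

/-- **THE PRINTED FREE-ENERGY ESTIMATE OVER-ESTIMATES WITH TOO FEW RECORDS.**  `ΔF̂_N = −log Ẑ_N`;
for `t ≥ 0`, `N ≤ exp(E_{P_R}[ΔF − W] − t)`, `N ≥ 1` and `δ ∈ (0, 1)`:
`P( ΔF̂_N ≤ ΔF + log(1/(1 − δ)) ) ≤ e^{−t/2} + P_R{ΔF − W ≤ E_{P_R}[ΔF − W] − t/2}/(1 − δ)` — outside
that event the estimate exceeds `ΔF` by more than `log(1/(1 − δ))` (the events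
`{Ẑ_N e^{ΔF} ≥ 1 − δ}` and `{−log Ẑ_N ≤ ΔF − log(1 − δ)}` coincide since `Ẑ_N > 0`). -/
theorem freeEnergyEstimate_sampleSize_necessary [IsFiniteMeasure ν₀] [IsFiniteMeasure ν₁]
    [IsMarkovKernel κF] [IsMarkovKernel κR] (h0 : ν₀ univ ≠ 0) (h1 : ν₁ univ ≠ 0)
    (h : CrooksPair ν₀ ν₁ κF κR s e W) {ΔF : ℝ}
    (hΔF : Real.exp (-ΔF) = ((ν₀ univ)⁻¹ * ν₁ univ).toReal) {t : ℝ} (ht : 0 ≤ t) {N : ℕ}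
    (hN0 : N ≠ 0) (hN : (N : ℝ) ≤ Real.exp ((∫ ε, (ΔF - W ε) ∂(fwdPathLaw ν₁ κR)) - t))
    {δ : ℝ} (hδ0 : 0 < δ) (hδ1 : δ < 1) :
    ((Measure.pi fun _ : Fin N => fwdPathLaw ν₀ κF)
        {x | -Real.log ((1 / (N : ℝ)) * ∑ i, Real.exp (-W (x i))) ≤ ΔF - Real.log (1 - δ)}).toReal
      ≤ Real.exp (-t / 2)
        + ((fwdPathLaw ν₁ κR) {ε | ΔF - W ε ≤ (∫ ε', (ΔF - W ε') ∂(fwdPathLaw ν₁ κR)) - t / 2}).toReal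
          / (1 - δ) := by
  have key := h.sampleSize_necessary h0 h1 hΔF ht hN hδ0 hδ1
  have hNpos : (0 : ℝ) < N := by exact_mod_cast Nat.pos_of_ne_zero hN0
  -- the two events coincide
  have hev : {x : Fin N → E | -Real.log ((1 / (N : ℝ)) * ∑ i, Real.exp (-W (x i)))
        ≤ ΔF - Real.log (1 - δ)}
      = {x : Fin N → E | 1 - δ ≤ (1 / (N : ℝ)) * ∑ i, Real.exp (ΔF - W (x i))} := by
    ext x
    simp only [mem_setOf_eq]
    have hfac : (1 / (N : ℝ)) * ∑ i, Real.exp (ΔF - W (x i))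
        = Real.exp ΔF * ((1 / (N : ℝ)) * ∑ i, Real.exp (-W (x i))) := by
      rw [Finset.mul_sum, Finset.mul_sum, Finset.mul_sum]
      refine Finset.sum_congr rfl fun i _ => ?_
      rw [sub_eq_add_neg, Real.exp_add]; ring
    rw [hfac]
    rcases Nat.eq_zero_or_pos N with hz | _
    · exact absurd hz hN0
    by_cases hZ : 0 < (1 / (N : ℝ)) * ∑ i, Real.exp (-W (x i))
    · rw [← Real.log_le_log_iff (by linarith : 0 < 1 - δ) (mul_pos (Real.exp_pos _) hZ),
        Real.log_mul (Real.exp_pos _).ne' hZ.ne', Real.log_exp]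
      constructor <;> intro hx <;> linarith
    · -- impossible for `N ≥ 1` (a sum of exponentials), but both sides are decidable anyway
      exfalso
      apply hZ
      haveI : Nonempty (Fin N) := ⟨⟨0, Nat.pos_of_ne_zero hN0⟩⟩
      exact mul_pos (by positivity) (Finset.sum_pos (fun i _ => Real.exp_pos _)
        Finset.univ_nonempty)
  rw [hev]
  exact key

/-- From the `L¹` error to a PROBABILITY of relative error (Markov): with
`N ≥ exp(E_{P_R}[ΔF − W] + t)` independent forward records and any `η > 0`,
`P(|Ẑ_N e^{ΔF} − 1| ≥ η) ≤ (e^{−t/4} + 2√(P_R{…}))/η`. -/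
theorem jarzynski_relError_prob_le [IsFiniteMeasure ν₀] [IsFiniteMeasure ν₁]
    [IsMarkovKernel κF] [IsMarkovKernel κR] (h0 : ν₀ univ ≠ 0) (h1 : ν₁ univ ≠ 0)
    (h : CrooksPair ν₀ ν₁ κF κR s e W) {ΔF : ℝ}
    (hΔF : Real.exp (-ΔF) = ((ν₀ univ)⁻¹ * ν₁ univ).toReal) {t : ℝ} (ht : 0 ≤ t) {N : ℕ}
    (hN : Real.exp ((∫ ε, (ΔF - W ε) ∂(fwdPathLaw ν₁ κR)) + t) ≤ N) {η : ℝ} (hη : 0 < η) :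
    ((Measure.pi fun _ : Fin N => fwdPathLaw ν₀ κF)
        {x | η ≤ |(1 / (N : ℝ)) * ∑ i, Real.exp (ΔF - W (x i)) - 1|}).toReal
      ≤ (Real.exp (-t / 4) + 2 * Real.sqrt ((fwdPathLaw ν₁ κR)
            {ε | (∫ ε', (ΔF - W ε') ∂(fwdPathLaw ν₁ κR)) + t / 2 < ΔF - W ε}).toReal) / η := by
  haveI := isProbabilityMeasure_fwdPathLaw ν₀ h0 κF
  have key := h.jarzynski_sampleSize_sufficient h0 h1 hΔF ht hN
  set P := Measure.pi fun _ : Fin N => fwdPathLaw ν₀ κF with hP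
  set Y : (Fin N → E) → ℝ := fun x => |(1 / (N : ℝ)) * ∑ i, Real.exp (ΔF - W (x i)) - 1| with hY
  have hW := h.measurable_W
  have hYm : Measurable Y := by
    refine Measurable.abs ((measurable_const.mul (Finset.measurable_sum _ fun i _ => ?_)).sub
      measurable_const)
    exact Real.measurable_exp.comp (measurable_const.sub (hW.comp (measurable_pi_apply i)))
  rw [le_div_iff₀ hη]
  by_cases hint : Integrable Y P
  · have hmk := mul_meas_ge_le_integral_of_nonneg (μ := P) (f := Y)
      (Eventually.of_forall fun x => abs_nonneg _) hint η
    calc (P {x | η ≤ Y x}).toReal * η = η * P.real {x | η ≤ Y x} := by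
          rw [measureReal_def, mul_comm]
      _ ≤ ∫ x, Y x ∂P := hmk
      _ ≤ _ := key
  · -- not integrable: the Bochner integral is `0`, so the printed bound is `≥ 0`… but then `key`
    -- says `0 ≤ bound`; we bound the probability by `1 ≤`? No: use `P ≤ 1` and `η ≤ E` fails.
    -- Instead note `Y` IS integrable: bounded below by 0 and `key` came from an honest integral;
    -- integrability holds since each summand is integrable (`P_F`-marginals, `e^{ΔF−W} ∈ L¹(P_F)`).
    exfalso
    apply hint
    have hL1 : Integrable (fun ε => Real.exp (ΔF - W ε)) (fwdPathLaw ν₀ κF) := by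
      have := (h.integrable_exp_neg_work h0).const_mul (Real.exp ΔF)
      refine this.congr (Eventually.of_forall fun ε => ?_)
      simp only
      rw [sub_eq_add_neg, Real.exp_add]
    have hsum : Integrable (fun x : Fin N → E => (1 / (N : ℝ)) * ∑ i, Real.exp (ΔF - W (x i))) P :=
      (integrable_finsetSum _ fun i _ =>
        (measurePreserving_eval (fun _ : Fin N => fwdPathLaw ν₀ κF) i).integrable_comp_of_integrable
          hL1).const_mul _
    exact (hsum.sub (integrable_const _)).abs

/-- **THE REVERSE LANE** (the pair read backwards): records of the REVERSE process estimate `e^{+ΔF}`,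
and `N ≥ exp(E_{P_F}[W − ΔF] + t)` independent reverse records — the FORWARD dissipation in the
exponent — give `E|(1/N)Σᵢ f(εᵢ)e^{W(εᵢ) − ΔF} − E_{P_F} f| ≤ ‖f‖_{L²(P_F)}·(e^{−t/4} + 2√(P_F{E_{P_F}[W − ΔF] + t/2 < W − ΔF}))`. -/
theorem sampleSize_sufficient_rev [IsFiniteMeasure ν₀] [IsFiniteMeasure ν₁] [IsMarkovKernel κF]
    [IsMarkovKernel κR] (h0 : ν₀ univ ≠ 0) (h1 : ν₁ univ ≠ 0)
    (h : CrooksPair ν₀ ν₁ κF κR s e W) {ΔF : ℝ}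
    (hΔF : Real.exp (-ΔF) = ((ν₀ univ)⁻¹ * ν₁ univ).toReal)
    {f : E → ℝ} (hf : Measurable f) (hf2 : MemLp f 2 (fwdPathLaw ν₀ κF))
    {t : ℝ} (ht : 0 ≤ t) {N : ℕ}
    (hN : Real.exp ((∫ ε, (W ε - ΔF) ∂(fwdPathLaw ν₀ κF)) + t) ≤ N) :
    ∫ x, |(1 / (N : ℝ)) * ∑ i, f (x i) * Real.exp (W (x i) - ΔF) - ∫ ε, f ε ∂(fwdPathLaw ν₀ κF)|
        ∂(Measure.pi fun _ : Fin N => fwdPathLaw ν₁ κR)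
      ≤ Real.sqrt (∫ ε, f ε ^ 2 ∂(fwdPathLaw ν₀ κF)) *
          (Real.exp (-t / 4) + 2 * Real.sqrt ((fwdPathLaw ν₀ κF)
            {ε | (∫ ε', (W ε' - ΔF) ∂(fwdPathLaw ν₀ κF)) + t / 2 < W ε - ΔF}).toReal) := by
  have key := h.symm.sampleSize_sufficient h1 h0 (exp_freeEnergyDiff h0 h1 hΔF) hf hf2 ht
    (N := N) (by simpa only [neg_sub_neg, sub_neg_eq_add, neg_add_eq_sub] using hN)
  simpa only [sub_neg_eq_add, neg_add_eq_sub] using key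

end CrooksPair

end Summit.Ventures.LatticeQCDFlow.Exactness.GeneralNCMC
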